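import Literature.Geometry.Riemannian.TensionFieldRegularity
import Literature.Geometry.Lorentzian.DivergenceTheorem
import Literature.Geometry.Lorentzian.LeviCivitaProofs
import HarnessLib

/-!
# The tension field in local coordinates: the harmonic map operator
(topic `Geometry/Riemannian`; Eells–Ratto 1993, Ch. I (1.7); Eells–Sampson 1964, §2 (6))

Eells–Ratto 1993, Ch. I (1.7): "In charts `τ(φ) = gⁱʲ(∇_{∂ᵢ} dφ)(∂ⱼ)`, i.e.
`τ(φ)^γ = Δ_M φ^γ + gⁱʲ ᴺΓ^γ_{αβ}(φ) φ^α_i φ^β_j`", with `Δ_M` the Laplace–Beltrami operator of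
`(M, g)` on functions and `ᴺΓ` the Christoffel symbols of `(N, h)`; Eells–Sampson 1964, §2,
equation (6). For the tree's `HarmonicMap.tensionField` (`TensionField.lean`) we PROVE this
coordinate description with respect to a chart of the TARGET `N` at a point `y₀` (coordinate
functions `y^α = chartCoord bN y₀ α`, coordinate frame `t_α = (trivializationAt y₀).localFrame bN α`,
`DivergenceTheorem.lean` / `ChartLaplacian.lean`), keeping the source side intrinsic:

* `localFrame_coeff_eq_mvfderiv_chartCoord` — frame coefficients on `N` are the differentials of
  the coordinate functions, `w^α = d(y^α)(w)`; `localFrame_coeff_mfderiv` — `(dφ w)^α = d(φ^α)(w)`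
  for the coordinate functions `φ^α = y^α ∘ φ` of the map;
* `localFrame_coeff_secondFF` — **`∇dφ` in target coordinates**:
  `∇dφ(v, Z)^γ = Hess_g(φ^γ)(v, Z) + ∑_{αβ} dφ^α(Z) dφ^β(v) (∇_{t_β} t_α)^γ ∘ φ`;
* `localFrame_coeff_tensionField` — **the harmonic map operator**:
  `τ(φ)^γ = Δ_g φ^γ + ∑_{αβ} ((∇_{t_β} t_α)^γ ∘ φ) · g⁻¹(dφ^α, dφ^β)`, with `Δ_g = tr_g Hess`
  (`PseudoRiemannianMetric.dalembertian`) and `g⁻¹` the inverse metric on covectors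
  (`PseudoRiemannianMetric.innerDual`); the frame Christoffel symbols
  `(∇_{t_β} t_α)^γ = t^γ(h.leviCivita t_α · (t_β ·))` are those computed from the metric
  coefficients by `two_mul_val_leviCivita_localFrame` (`ChartLaplacian.lean`).

Consequently the harmonic map equation `τ(φ) = 0` (`HarmonicMapTensionField.lean`:
`IsHarmonicMap ↔ τ ≡ 0` on closed manifolds) is, in target coordinates, the semilinear elliptic
system `Δ_g φ^γ + Γ^γ_{αβ}(φ) g⁻¹(dφ^α, dφ^β) = 0`, and the heat flow `∂ₜu = τ(u)` the
corresponding semilinear parabolic system (Eells–Sampson 1964, §6). Both models are taken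
boundaryless (`IM.Boundaryless`, `IN.Boundaryless`: the chart lemmas of `ChartLaplacian.lean`
and `DivergenceTheorem.lean` are stated for boundaryless models).

Everything is proved; there are no definitions and no named facts.

## References

* J. Eells, A. Ratto, *Harmonic Maps and Minimal Immersions with Symmetries*, Ann. of Math.
  Studies 130 (1993), Ch. I, (1.2), (1.5), (1.7). Held copy, PDF pp. 13–14. [EellsRatto1993]
* J. Eells, J. H. Sampson, *Harmonic mappings of Riemannian manifolds*, Amer. J. Math. 86 (1964),
  §2 (6). [EellsSampson1964]
* B. O'Neill, *Semi-Riemannian Geometry* (1983), Ch. 1, Def. 1.9 ff.; Ch. 3, Def. 3.48–3.50.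
  [ONeill1983]
-/

noncomputable section

open Bundle Set Function Filter
open scoped Manifold ContDiff Topology

namespace Literature.Geometry.Riemannian

open Lorentzian Lorentzian.PseudoRiemannianMetric

namespace HarmonicMap

/-! ### Frame coefficients on the target are differentials of the coordinate functions -/

section TargetFrame

variable {EN : Type*} [NormedAddCommGroup EN] [NormedSpace ℝ EN] [FiniteDimensional ℝ EN]
  {HN : Type*} [TopologicalSpace HN] {IN : ModelWithCorners ℝ EN HN}
  {N : Type*} [TopologicalSpace N] [ChartedSpace HN N] [IsManifold IN ∞ N] [IN.Boundaryless]
  {ι' : Type*} [Fintype ι'] [DecidableEq ι'] (bN : Module.Basis ι' ℝ EN) {y₀ y : N}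

/-- **Frame coefficients are the differentials of the coordinate functions**: on the chart
domain of `y₀`, the `α`-th coefficient of `w ∈ T_y N` in the coordinate frame
`tᵢ = (trivializationAt y₀).localFrame bN i` is `d(yᵅ)_y(w)`, `yᵅ = chartCoord bN y₀ α` the
`α`-th coordinate function (duality `d(yᵅ)(tᵢ) = δᵢᵅ`, `mvfderiv_chartCoord_localFrame`).
O'Neill 1983, Ch. 1, Def. 1.9 ff. [cite: ONeill1983, Ch. 1, Def. 1.9 ff] -/
theorem localFrame_coeff_eq_mvfderiv_chartCoord (hy : y ∈ (chartAt HN y₀).source)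
    (w : TangentSpace IN y) (α : ι') :
    (trivializationAt EN (TangentSpace IN : N → Type _) y₀).localFrame_coeff IN bN α y w =
      mvfderiv IN (chartCoord (I := IN) bN y₀ α) y w := by
  set Tr := trivializationAt EN (TangentSpace IN : N → Type _) y₀ with hTr
  have hyT : y ∈ Tr.baseSet := by simpa [hTr] using hy
  have hexp : w = ∑ i, Tr.localFrame_coeff IN bN i y w • Tr.localFrame bN i y := by
    conv_lhs => rw [← (Tr.basisAt bN hyT).sum_repr w]
    refine Finset.sum_congr rfl fun i _ ↦ ?_
    rw [Tr.localFrame_apply_of_mem_baseSet bN hyT,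
      Tr.localFrame_coeff_apply_of_mem_baseSet bN hyT (fun _ ↦ w) i]
  conv_rhs => rw [hexp]
  simp only [map_sum, map_smul, smul_eq_mul, hTr]
  simp_rw [mvfderiv_chartCoord_localFrame bN hy]
  simp

omit [FiniteDimensional ℝ EN] [IsManifold IN ∞ N] [IN.Boundaryless] [Fintype ι'] [DecidableEq ι'] in
/-- **Chain rule for `mvfderiv`** (scalar-valued functions): `d(f ∘ φ)_x v = df_{φ x}(dφ_x v)`.
[folklore] -/
theorem mvfderiv_comp_apply' {EM : Type*} [NormedAddCommGroup EM] [NormedSpace ℝ EM]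
    {HM : Type*} [TopologicalSpace HM] {IM : ModelWithCorners ℝ EM HM}
    {M : Type*} [TopologicalSpace M] [ChartedSpace HM M] {φ : M → N} {f : N → ℝ} {x : M}
    (hf : MDifferentiableAt IN 𝓘(ℝ, ℝ) f (φ x)) (hφ : MDifferentiableAt IM IN φ x)
    (v : TangentSpace IM x) :
    mvfderiv IM (f ∘ φ) x v = mvfderiv IN f (φ x) (mfderiv IM IN φ x v) := by
  simp only [mvfderiv, ContinuousLinearMap.comp_apply]
  rw [mfderiv_comp x hf hφ]
  rfl

omit [FiniteDimensional ℝ EN] [IN.Boundaryless] [DecidableEq ι'] in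
/-- Expansion of a tangent vector in the coordinate frame: `w = ∑ᵢ wⁱ tᵢ(y)` on the chart domain
of `y₀`. [folklore] -/
theorem eq_sum_localFrame_coeff_smul' (hy : y ∈ (chartAt HN y₀).source) (w : TangentSpace IN y) :
    w = ∑ i, (trivializationAt EN (TangentSpace IN : N → Type _) y₀).localFrame_coeff IN bN i y w •
      (trivializationAt EN (TangentSpace IN : N → Type _) y₀).localFrame bN i y := by
  set Tr := trivializationAt EN (TangentSpace IN : N → Type _) y₀ with hTr
  have hyT : y ∈ Tr.baseSet := by simpa [hTr] using hy
  conv_lhs => rw [← (Tr.basisAt bN hyT).sum_repr w]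
  refine Finset.sum_congr rfl fun i _ ↦ ?_
  rw [Tr.localFrame_apply_of_mem_baseSet bN hyT,
    Tr.localFrame_coeff_apply_of_mem_baseSet bN hyT (fun _ ↦ w) i]

/-- The coordinate frame vectors have coordinates `δ`: `(tᵢ(y))ᵅ = δᵢᵅ`. [folklore] -/
theorem localFrame_coeff_localFrame' (hy : y ∈ (chartAt HN y₀).source) (i α : ι') :
    (trivializationAt EN (TangentSpace IN : N → Type _) y₀).localFrame_coeff IN bN α y
      ((trivializationAt EN (TangentSpace IN : N → Type _) y₀).localFrame bN i y) =
      if i = α then 1 else 0 := by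
  rw [localFrame_coeff_eq_mvfderiv_chartCoord bN hy, mvfderiv_chartCoord_localFrame bN hy]

end TargetFrame

/-! ### The second fundamental form and the tension field in target coordinates -/

section MapCoordinates

variable {EM : Type*} [NormedAddCommGroup EM] [NormedSpace ℝ EM] [FiniteDimensional ℝ EM]
  [CompleteSpace EM] {HM : Type*} [TopologicalSpace HM] {IM : ModelWithCorners ℝ EM HM}
  [IM.Boundaryless] {M : Type*} [TopologicalSpace M] [ChartedSpace HM M] [IsManifold IM ∞ M]
  {EN : Type*} [NormedAddCommGroup EN] [NormedSpace ℝ EN] [FiniteDimensional ℝ EN]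
  [CompleteSpace EN] {HN : Type*} [TopologicalSpace HN] {IN : ModelWithCorners ℝ EN HN}
  [IN.Boundaryless] {N : Type*} [TopologicalSpace N] [ChartedSpace HN N] [IsManifold IN ∞ N]

variable (g : ContMDiffRiemannianMetric IM ∞ EM (TangentSpace IM : M → Type _))
  [(ofRiemannian g).HasLeviCivita]
  (h : PseudoRiemannianMetric IN ∞ EN (TangentSpace IN : N → Type _)) [h.HasLeviCivita]
  {φ : M → N} (hφ : ContMDiff IM IN ∞ φ)
  {ι' : Type*} [Fintype ι'] [DecidableEq ι'] (bN : Module.Basis ι' ℝ EN) (y₀ : N)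

include hφ in
omit [FiniteDimensional ℝ EM] [CompleteSpace EM] [IM.Boundaryless] [IsManifold IM ∞ M]
  [CompleteSpace EN] in
/-- **`(dφ_y w)ᵅ = d(φᵅ)_y(w)`**: the coordinates of `dφ(w)` in the coordinate frame of `N` at `y₀`
are the differentials of the coordinate functions `φᵅ = yᵅ ∘ φ` of the map (chain rule).
[cite: EellsRatto1993, Ch. I (1.2)] -/
theorem localFrame_coeff_mfderiv {y : M} (hy : φ y ∈ (chartAt HN y₀).source)
    (w : TangentSpace IM y) (α : ι') :
    (trivializationAt EN (TangentSpace IN : N → Type _) y₀).localFrame_coeff IN bN α (φ y)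
      (mfderiv IM IN φ y w) = mvfderiv IM (fun y ↦ chartCoord (I := IN) bN y₀ α (φ y)) y w := by
  rw [localFrame_coeff_eq_mvfderiv_chartCoord bN hy]
  exact (mvfderiv_comp_apply' ((contMDiffAt_chartCoord bN hy α).mdifferentiableAt (by simp))
    ((hφ y).mdifferentiableAt (by simp)) w).symm

include hφ in
omit [CompleteSpace EN] in
/-- **The second fundamental form of a map in target coordinates** (Eells–Ratto 1993, Ch. I
(1.5)/(1.7) in charts): for `x` with `φ x` in the chart domain of `y₀`, a vector field `Z`
`C^∞` near `x` and `v ∈ T_x M`, the `γ`-th coordinate of `∇dφ(v, Z)(x)` in the coordinate frame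
`tᵢ` of `N` at `y₀` is
`Hess_g(φ^γ)_x(v, Z x) + ∑_{αβ} d(φᵅ)(Z x) d(φᵝ)(v) (∇_{t_β} t_α)^γ(φ x)`,
with `φᵅ = yᵅ ∘ φ` the coordinate functions of the map and `(∇_{t_β} t_α)^γ` the frame
Christoffel symbols of `h`. Proof: `∇dφ(v,Z) = D_v(dφ Z) − dφ(∇_v Z)`; the fixed-frame formula
`normalDerivAlong_eq_frame` for `D_v(dφ Z)` whose frame coefficients are `Z(φⁱ)`
(`localFrame_coeff_mfderiv`); `Hess f(v, Z x) = v(Z f) − (∇_v Z) f` (`hessian_apply_holds`).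
[cite: EellsRatto1993, Ch. I (1.5), (1.7)] -/
theorem localFrame_coeff_secondFF {x : M} (hx : φ x ∈ (chartAt HN y₀).source)
    {Z : Π y : M, TangentSpace IM y} (hZ : ∀ᶠ y in 𝓝 x, CMDiffAt ∞ (T% Z) y)
    (v : TangentSpace IM x) (γ : ι') :
    (trivializationAt EN (TangentSpace IN : N → Type _) y₀).localFrame_coeff IN bN γ (φ x)
        (secondFF g h φ x v Z) =
      (ofRiemannian g).hessian (fun y ↦ chartCoord (I := IN) bN y₀ γ (φ y)) x v (Z x) +
        ∑ α, ∑ β, mvfderiv IM (fun y ↦ chartCoord (I := IN) bN y₀ α (φ y)) x (Z x) *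
          mvfderiv IM (fun y ↦ chartCoord (I := IN) bN y₀ β (φ y)) x v *
          (trivializationAt EN (TangentSpace IN : N → Type _) y₀).localFrame_coeff IN bN γ (φ x)
            (h.leviCivita ((trivializationAt EN (TangentSpace IN : N → Type _) y₀).localFrame bN α)
              (φ x) ((trivializationAt EN (TangentSpace IN : N → Type _) y₀).localFrame bN β (φ x))) := by
  classical
  have hUo : IsOpen (φ ⁻¹' (chartAt HN y₀).source) :=
    (chartAt HN y₀).open_source.preimage hφ.continuous
  have hnear : ∀ᶠ y in 𝓝 x, φ y ∈ (chartAt HN y₀).source := hUo.mem_nhds hx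
  have hFs : ∀ α, CMDiffAt ∞ (fun y ↦ chartCoord (I := IN) bN y₀ α (φ y)) x := fun α ↦
    (contMDiffAt_chartCoord bN hx α).comp x (hφ x)
  have hZx : CMDiffAt ∞ (T% Z) x := hZ.self_of_nhds
  -- the field `ν = dφ(Z)` along `φ` and its frame coefficients `cⁱ = Z(φⁱ)`
  have hν : ∀ᶠ y in 𝓝 x, ContMDiffAt IM IN.tangent ∞
      (fun y ↦ (TotalSpace.mk' EN (φ y) (mfderiv IM IN φ y (Z y)) : TangentBundle IN N)) y := by
    filter_upwards [hZ] with y hy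
    exact (hφ.contMDiff_tangentMap (le_of_eq rfl)).contMDiffAt.comp y hy
  have hcF : ∀ i, (fun y ↦ (trivializationAt EN (TangentSpace IN : N → Type _) y₀).localFrame_coeff
      IN bN i (φ y) (mfderiv IM IN φ y (Z y))) =ᶠ[𝓝 x]
      fun y ↦ mvfderiv IM (fun y ↦ chartCoord (I := IN) bN y₀ i (φ y)) y (Z y) := fun i ↦ by
    filter_upwards [hnear] with y hy
    exact localFrame_coeff_mfderiv hφ bN y₀ hy (Z y) i
  have hcx : ∀ i, (trivializationAt EN (TangentSpace IN : N → Type _) y₀).localFrame_coeff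
      IN bN i (φ x) (mfderiv IM IN φ x (Z x)) =
      mvfderiv IM (fun y ↦ chartCoord (I := IN) bN y₀ i (φ y)) x (Z x) := fun i ↦
    localFrame_coeff_mfderiv hφ bN y₀ hx (Z x) i
  -- the fixed-frame formula for `D_v ν`
  have hD := normalDerivAlong_eq_frame h bN (f := φ) (x₁ := y₀) (y := x) hx
    BoundarylessManifold.isInteriorPoint (hν.self_of_nhds.mdifferentiableAt (by simp)) v
  -- expand `dφ v` in the frame: the `Γ`-term
  have hdφv := eq_sum_localFrame_coeff_smul' bN hx (mfderiv IM IN φ x v)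
  have hΓ : ∀ i, (trivializationAt EN (TangentSpace IN : N → Type _) y₀).localFrame_coeff IN bN γ
      (φ x) (h.leviCivita ((trivializationAt EN (TangentSpace IN : N → Type _) y₀).localFrame bN i)
        (φ x) (mfderiv IM IN φ x v)) =
      ∑ β, mvfderiv IM (fun y ↦ chartCoord (I := IN) bN y₀ β (φ y)) x v *
        (trivializationAt EN (TangentSpace IN : N → Type _) y₀).localFrame_coeff IN bN γ (φ x)
          (h.leviCivita ((trivializationAt EN (TangentSpace IN : N → Type _) y₀).localFrame bN i)
            (φ x) ((trivializationAt EN (TangentSpace IN : N → Type _) y₀).localFrame bN β (φ x))) := by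
    intro i
    conv_lhs => rw [hdφv]
    simp only [map_sum, map_smul, smul_eq_mul, localFrame_coeff_mfderiv hφ bN y₀ hx]
  -- the Hessian of `φ^γ`
  have hXvs : MDiffAt (T% (FiberBundle.extend EM v : Π y : M, TangentSpace IM y)) x :=
    (FiberBundle.contMDiffAt_extend (I := IM) (F := EM) (V := (TangentSpace IM : M → Type _))
      (k := 1) v).mdifferentiableAt one_ne_zero
  have hHess := hessian_apply_holds (g := ofRiemannian g) (x := x)
    (f := fun y ↦ chartCoord (I := IN) bN y₀ γ (φ y))
    ((hFs γ).of_le (by norm_cast)) hXvs (hZx.mdifferentiableAt (by simp))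
  rw [FiberBundle.extend_apply_self (F := EM) v] at hHess
  rw [hHess, hessianAux, FiberBundle.extend_apply_self (F := EM) v]
  -- `v(c^γ) = v(Z φ^γ)`
  have hmf : (mfderiv IM 𝓘(ℝ, ℝ) (fun y ↦ (trivializationAt EN (TangentSpace IN : N → Type _)
      y₀).localFrame_coeff IN bN γ (φ y) (mfderiv IM IN φ y (Z y))) x v : ℝ) =
      mvfderiv IM (fun y ↦ mvfderiv IM (fun y ↦ chartCoord (I := IN) bN y₀ γ (φ y)) y (Z y)) x v := by
    rw [← mvfderiv_congr_of_eventuallyEq (hcF γ)]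
    rfl
  -- assemble
  rw [secondFF, map_sub, hD]
  simp only [map_add, map_sum, map_smul, smul_eq_mul, localFrame_coeff_localFrame' bN hx,
    mul_ite, mul_one, mul_zero, Finset.sum_ite_eq', Finset.mem_univ, if_true]
  rw [hmf, localFrame_coeff_mfderiv hφ bN y₀ hx _ γ]
  simp only [hcx, hΓ, Finset.mul_sum]
  have hre : ∀ i β, mvfderiv IM (fun y ↦ chartCoord (I := IN) bN y₀ i (φ y)) x (Z x) *
      (mvfderiv IM (fun y ↦ chartCoord (I := IN) bN y₀ β (φ y)) x v *
        (trivializationAt EN (TangentSpace IN : N → Type _) y₀).localFrame_coeff IN bN γ (φ x)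
          (h.leviCivita ((trivializationAt EN (TangentSpace IN : N → Type _) y₀).localFrame bN i)
            (φ x) ((trivializationAt EN (TangentSpace IN : N → Type _) y₀).localFrame bN β (φ x)))) =
      mvfderiv IM (fun y ↦ chartCoord (I := IN) bN y₀ i (φ y)) x (Z x) *
        mvfderiv IM (fun y ↦ chartCoord (I := IN) bN y₀ β (φ y)) x v *
        (trivializationAt EN (TangentSpace IN : N → Type _) y₀).localFrame_coeff IN bN γ (φ x)
          (h.leviCivita ((trivializationAt EN (TangentSpace IN : N → Type _) y₀).localFrame bN i)
            (φ x) ((trivializationAt EN (TangentSpace IN : N → Type _) y₀).localFrame bN β (φ x))) :=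
    fun i β ↦ by ring
  simp only [hre]
  ring

/-- Reordering a fourfold finite sum. [folklore] -/
private theorem sum_four_comm {κ κ' : Type*} [Fintype κ] [Fintype κ'] (T : κ → κ → κ' → κ' → ℝ) :
    ∑ k, ∑ l, ∑ α, ∑ β, T k l α β = ∑ α, ∑ β, ∑ k, ∑ l, T k l α β := by
  have h1 : ∀ k, ∑ l, ∑ α, ∑ β, T k l α β = ∑ α, ∑ l, ∑ β, T k l α β := fun k ↦ Finset.sum_comm
  simp only [h1]
  rw [Finset.sum_comm]
  refine Finset.sum_congr rfl fun α _ ↦ ?_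
  have h2 : ∀ k, ∑ l, ∑ β, T k l α β = ∑ β, ∑ l, T k l α β := fun k ↦ Finset.sum_comm
  simp only [h2]
  exact Finset.sum_comm

include hφ in
omit [CompleteSpace EN] in
/-- **The tension field in target coordinates — the harmonic map operator**
(Eells–Ratto 1993, Ch. I (1.7): "`τ(φ)^γ = Δ_M φ^γ + gⁱʲ ᴺΓ^γ_{αβ}(φ) φ^α_i φ^β_j`"; Eells–Sampson
1964, §2 (6)): for a `C^∞` map `φ` and a point `x` with `φ x` in the chart domain of `y₀`, the
`γ`-th coordinate of `τ(φ)(x)` in the coordinate frame `tᵢ` of `N` at `y₀` is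
`Δ_g(φ^γ)(x) + ∑_{αβ} (∇_{t_β} t_α)^γ(φ x) · g⁻¹_x(dφ^α, dφ^β)`,
where `φ^α = y^α ∘ φ` are the coordinate functions of the map, `Δ_g = tr_g Hess` is the
Laplace–Beltrami operator of `g` on functions (`dalembertian`) and `g⁻¹_x` the inverse metric on
covectors (`innerDual`). This is the second-order semilinear elliptic operator of harmonic map
theory; its vanishing is the harmonic map equation in local coordinates on the target.
Proof: `τ = ∑ₖₗ (𝒢⁻¹)ₖₗ ∇dφ(sₖ, sₗ)` in the coordinate frame of `M` at `x` (`tensionField_eq`),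
the coordinate formula `localFrame_coeff_secondFF` for each term, `Δ_g f = ∑ (𝒢⁻¹)ₖₗ Hess f(sₖ, sₗ)`
(`trace_eq_sum_gram_inv`) and `g⁻¹(du, dv) = ∑ (𝒢⁻¹)ₖₗ du(sₖ) dv(sₗ)` (`innerDual_eq_sum_localFrame`).
[cite: EellsRatto1993, Ch. I (1.7)] [cite: EellsSampson1964, §2 (6)] -/
theorem localFrame_coeff_tensionField {x : M} (hx : φ x ∈ (chartAt HN y₀).source) (γ : ι') :
    (trivializationAt EN (TangentSpace IN : N → Type _) y₀).localFrame_coeff IN bN γ (φ x)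
        (tensionField g h φ x) =
      (ofRiemannian g).dalembertian (fun y ↦ chartCoord (I := IN) bN y₀ γ (φ y)) x +
        ∑ α, ∑ β, (trivializationAt EN (TangentSpace IN : N → Type _) y₀).localFrame_coeff IN bN γ
            (φ x) (h.leviCivita ((trivializationAt EN (TangentSpace IN : N → Type _) y₀).localFrame
              bN α) (φ x) ((trivializationAt EN (TangentSpace IN : N → Type _) y₀).localFrame bN β
                (φ x))) *
          (ofRiemannian g).innerDual x
            (mvfderiv IM (fun y ↦ chartCoord (I := IN) bN y₀ α (φ y)) x).toLinearMap
            (mvfderiv IM (fun y ↦ chartCoord (I := IN) bN y₀ β (φ y)) x).toLinearMap := by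
  classical
  haveI : FiniteDimensional ℝ (TangentSpace IM x) := inferInstanceAs (FiniteDimensional ℝ EM)
  have hxe : x ∈ (trivializationAt EM (TangentSpace IM : M → Type _) x).baseSet :=
    FiberBundle.mem_baseSet_trivializationAt' x
  have hxc : x ∈ (chartAt HM x).source := mem_chart_source HM x
  -- the frame fields of `M` at `x` are smooth near `x`
  have hs : ∀ l, ∀ᶠ y in 𝓝 x, CMDiffAt ∞ (T% ((trivializationAt EM (TangentSpace IM : M → Type _)
      x).localFrame (Module.finBasis ℝ EM) l)) y := fun l ↦ by
    filter_upwards [(trivializationAt EM (TangentSpace IM : M → Type _) x).open_baseSet.mem_nhds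
      hxe] with y hy
    exact contMDiffAt_localFrame_of_mem ∞ _ (Module.finBasis ℝ EM) l hy
  -- `τ` in the canonical frame, coordinate by coordinate
  rw [tensionField_eq]
  simp only [map_sum, map_smul, smul_eq_mul, localFrame_coeff_secondFF g h hφ bN y₀ hx (hs _)]
  simp only [mul_add, Finset.sum_add_distrib]
  congr 1
  · -- the Laplace–Beltrami operator of `φ^γ`
    rw [PseudoRiemannianMetric.dalembertian, trace_eq_sum_gram_inv (ofRiemannian g) x
      ((trivializationAt EM (TangentSpace IM : M → Type _) x).basisAt (Module.finBasis ℝ EM) hxe)]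
    simp only [← (trivializationAt EM (TangentSpace IM : M → Type _) x).localFrame_apply_of_mem_baseSet
      (Module.finBasis ℝ EM) hxe]
    refine Finset.sum_congr rfl fun k _ ↦ Finset.sum_congr rfl fun l _ ↦ ?_
    rw [gramInv_symm' g _ (Module.finBasis ℝ EM) x k l]
  · -- the nonlinear term
    simp only [innerDual_eq_sum_localFrame (ofRiemannian g) (Module.finBasis ℝ EM) hxc,
      ContinuousLinearMap.coe_coe, Finset.mul_sum]
    rw [sum_four_comm]
    refine Finset.sum_congr rfl fun α _ ↦ Finset.sum_congr rfl fun β _ ↦ ?_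
    rw [Finset.sum_comm]
    refine Finset.sum_congr rfl fun l _ ↦ Finset.sum_congr rfl fun k _ ↦ ?_
    ring

end MapCoordinates

end HarmonicMap

end Literature.Geometry.Riemannian

end
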